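import Summits.CriticalPhenomena.PercolationContinuityZ3.Theorems.PercNearOneGluingNoHeavyLowerTailGeometricMomentCIL
import Summits.CriticalPhenomena.PercolationContinuityZ3.Theorems.PercNearOneGluingNoHeavyLowerTailTopPacking
import HarnessLib

/-!
# `NoHeavyLowerTail` (stmt-CriticalPhenomena-4575) — the GEOMETRIC-MOMENT TOP PACKING (GM-TP) closes the crux

Typed reduction (hull-port / coupling seat `prim-hp-1`, gen 4; `--supports stmt-CriticalPhenomena-4575`).  No definitions,
no named facts, no sorries.  Notation of `…GeometricMomentCIL`: `μ = prodBernoulli w` on `Fin n`, relays `A` (`k = |A|`),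
observer `o ∉ A`, `π(x) = {a ∈ A : x ↔ a}`, `N = |π(o)|`, a parameter `v ∈ (0, 1]`, and the two polynomials

  `L(v) = Σ_{j=1}^{k} v^j μ{N = j}`,   `R_x(v) = Σ_{j=0}^{k} v^j μ{|π(x)| = j}`   (`= E[v^N; N ≥ 1]`, `E[v^{|π(x)|}]`).

For a ranking `rk` of the relays (injective on `A`) let `top(π(o))` be the `rk`-first relay of `o`'s block and

  `T_x(v) = Σ_{j=1}^{k} v^j μ{N = j, o ↔ x, o ↮ every y ∈ A with rk y < rk x}`   (`= E[v^N; top(π(o)) = x]`).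

**GM-TP(C)** (geometric-moment top packing): for every instance, every `v ∈ (0,1]` and every ranking `rk`, injective on `A`
and along which `R_·(v)` is non-increasing (champion = most-often-cold relay first),  `Σ_{x ∈ A} T_x(v) / R_x(v) ≤ C`.

* `noHeavyLowerTail_of_geometricMomentTopPacking` — **GM-TP(C) for some `C ≥ 0` ⇒ `NoHeavyLowerTail`**: since `L(v) = Σ_x T_x(v)`
  (partition by the top relay) and `T_x ≤ R_x`, `L(v) = Σ_x R_x (T_x/R_x) ≤ (max_x R_x) · Σ_x T_x/R_x ≤ C · max_x R_x(v)`, which is the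
  hypothesis GM-CIL(C) of `Theorems.noHeavyLowerTail_of_geometricMomentCIL`.

WHY (the smooth sibling of the level-wise top packing `TP_j` of `…TopPacking`, and of worst-first gluing):  in the "uniform virtual star
sink" reading of GM-CIL (a new vertex `b` joined to every relay with weight `1 − v`; `R_x(v) = μ(x ↮ b)`, `L(v) = μ(o ↔ A, o ↮ b)`), GM-TP is
the worst-first gluing packing `Σ_x μ(top(π(o)) = x, o ↔ A, o ↮ b)/μ(x ↮ b) ≤ C` of `…WorstFirstGluing` RESTRICTED to uniform star sinks; at
`v → 0` it is Kozma–Nitzan's Lemma 2 (singleton blocks), at `v = 1` it is `μ(N ≥ 1) ≤ C`.  Seat census (exact partition DP, random weighted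
graphs `n ≤ 8`, `k ≤ 7`, weight palettes with `1` and `ε`, 8–100 values of `v`, adversarial climbs): 0 violations of GM-TP(1); `= 1` exactly when `o` is
glued to a relay.  Hub calibration: GM-TP(1) on hub instances is strictly between worst-first gluing (additive class) and the Conjecture-1-hard
`Ω`-form — it is a crux-strength statement whose only extra structure is the single smooth parameter `v`.
-/

noncomputable section

namespace Summit.CriticalPhenomena.PercolationContinuityZ3.Theorems

open MeasureTheory Set Literature.Probability.LatticeModels Literature.Probability.Percolation
open scoped Classical BigOperators

variable {n : ℕ}

namespace GMTopPacking

/-- The level-`j` top event `W^j_x = {N = j} ∩ {o ↔ x} ∩ {o ↮ rk-earlier relays}`, `j ≥ 1`, is covered: `{N = j} ⊆ ⋃_x W^j_x`. [folklore] -/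
theorem level_subset_biUnion (A : Finset (Fin n)) (o : Fin n) {j : ℕ} (hj : 1 ≤ j) (rk : Fin n → ℕ) :
    {ω : BondConfig (Fin n) | (A.filter fun z => ω ∈ openConn o z).card = j} ⊆
    ⋃ x ∈ A, ({ω : BondConfig (Fin n) | (A.filter fun z => ω ∈ openConn o z).card = j} ∩
      {ω | ω ∈ openConn o x} ∩ {ω | ∀ y ∈ A, rk y < rk x → ω ∉ openConn o y}) := by
  intro ω hω
  have hω' : ω ∈ {ω : BondConfig (Fin n) | 1 ≤ (A.filter fun z => ω ∈ openConn o z).card ∧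
      (A.filter fun z => ω ∈ openConn o z).card ≤ j} := by
    simp only [mem_setOf_eq] at hω ⊢; omega
  obtain ⟨x, hx, hmem⟩ := mem_iUnion₂.1 (TopPacking.L_subset_biUnion A o j rk hω')
  exact mem_iUnion₂.2 ⟨x, hx, ⟨hω, hmem.1.2⟩, hmem.2⟩

/-- The level-`j` top events are pairwise disjoint for a ranking injective on `A`. [folklore] -/
theorem pairwiseDisjoint_level (A : Finset (Fin n)) (o : Fin n) (j : ℕ) (rk : Fin n → ℕ)
    (hrk : Set.InjOn rk ↑A) :
    (↑A : Set (Fin n)).PairwiseDisjoint fun x =>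
      ({ω : BondConfig (Fin n) | (A.filter fun z => ω ∈ openConn o z).card = j} ∩
        {ω | ω ∈ openConn o x} ∩ {ω | ∀ y ∈ A, rk y < rk x → ω ∉ openConn o y}) := by
  intro x hx y hy hxy
  rw [Function.onFun, Set.disjoint_left]
  rintro ω ⟨⟨_, hox⟩, hx'⟩ ⟨⟨_, hoy⟩, hy'⟩
  have hne : rk x ≠ rk y := fun h => hxy (hrk hx hy h)
  rcases lt_or_gt_of_ne hne with h | h
  · exact hy' x hx h hox
  · exact hx' y hy h hoy

/-- **Partition of a level by the top relay**: `μ{N = j} = Σ_{x∈A} μ(W^j_x)` for `j ≥ 1`. [folklore] -/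
theorem real_level_eq_sum (w : Sym2 (Fin n) → unitInterval) (A : Finset (Fin n)) (o : Fin n) {j : ℕ}
    (hj : 1 ≤ j) (rk : Fin n → ℕ) (hrk : Set.InjOn rk ↑A) :
    (prodBernoulli w).real {ω : BondConfig (Fin n) | (A.filter fun z => ω ∈ openConn o z).card = j} =
      ∑ x ∈ A, (prodBernoulli w).real
        ({ω : BondConfig (Fin n) | (A.filter fun z => ω ∈ openConn o z).card = j} ∩
          {ω | ω ∈ openConn o x} ∩ {ω | ∀ y ∈ A, rk y < rk x → ω ∉ openConn o y}) := by
  rw [← measureReal_biUnion_finset (pairwiseDisjoint_level A o j rk hrk)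
    (fun _ _ => MeasurableSet.of_discrete)]
  congr 1
  apply Set.Subset.antisymm (level_subset_biUnion A o hj rk)
  intro ω hω
  obtain ⟨x, -, hx⟩ := mem_iUnion₂.1 hω
  exact hx.1.1

/-- `W^j_x ⊆ {|π(x)| = j}`: on `W^j_x` the block of `x` is the block of `o`. [folklore] -/
theorem level_top_subset (A : Finset (Fin n)) (o x : Fin n) (j : ℕ) (rk : Fin n → ℕ) :
    ({ω : BondConfig (Fin n) | (A.filter fun z => ω ∈ openConn o z).card = j} ∩
        {ω | ω ∈ openConn o x} ∩ {ω | ∀ y ∈ A, rk y < rk x → ω ∉ openConn o y}) ⊆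
    {ω : BondConfig (Fin n) | (A.filter fun z => ω ∈ openConn x z).card = j} := by
  rintro ω ⟨⟨hj, hox⟩, -⟩
  have hox' : ω ∈ openConn o x := hox
  rw [mem_setOf_eq, GuardedCIL.filter_eq_of_reachable A hox']
  exact hj

end GMTopPacking

open GMTopPacking GuardedTopPacking in
/-- **GM-TP(C) ⇒ GM-CIL(C) ⇒ `NoHeavyLowerTail`.**  If for some `C ≥ 0`, for every finite weighted graph, relay set `A`,
observer `o ∉ A`, parameter `v ∈ (0,1]` and every ranking `rk` injective on `A` along which `R_·(v)` is non-increasing, the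
geometric-moment top packing `Σ_{x∈A} T_x(v)/R_x(v) ≤ C` holds, then the crux holds (via
`Theorems.noHeavyLowerTail_of_geometricMomentCIL`: `L(v) = Σ_x T_x(v) ≤ C · max_x R_x(v)`). [this work] -/
theorem noHeavyLowerTail_of_geometricMomentTopPacking (C : ℝ) (hC : 0 ≤ C)
    (hGTP : ∀ (n : ℕ) (w : Sym2 (Fin n) → unitInterval) (A : Finset (Fin n)) (o : Fin n) (v : ℝ)
      (rk : Fin n → ℕ), 0 < v → v ≤ 1 → o ∉ A → Set.InjOn rk ↑A →
      (∀ x ∈ A, ∀ y ∈ A, rk x < rk y →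
        ∑ j ∈ Finset.range (A.card + 1), v ^ j * (prodBernoulli w).real {ω : BondConfig (Fin n) |
            (A.filter fun z => ω ∈ openConn y z).card = j} ≤
          ∑ j ∈ Finset.range (A.card + 1), v ^ j * (prodBernoulli w).real {ω : BondConfig (Fin n) |
            (A.filter fun z => ω ∈ openConn x z).card = j}) →
      ∑ x ∈ A,
        (∑ j ∈ Finset.Icc 1 A.card, v ^ j * (prodBernoulli w).real
            ({ω : BondConfig (Fin n) | (A.filter fun z => ω ∈ openConn o z).card = j} ∩
              {ω | ω ∈ openConn o x} ∩ {ω | ∀ y ∈ A, rk y < rk x → ω ∉ openConn o y})) /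
          (∑ j ∈ Finset.range (A.card + 1), v ^ j * (prodBernoulli w).real {ω : BondConfig (Fin n) |
            (A.filter fun z => ω ∈ openConn x z).card = j}) ≤ C) :
    Summit.CriticalPhenomena.PercolationContinuityZ3.Theses.PercNearOneGluing.NoHeavyLowerTail := by
  refine noHeavyLowerTail_of_geometricMomentCIL C hC fun n w A o v hv0 hv1 hA ho => ?_
  set μ := prodBernoulli w with hμ
  -- the moment polynomial `R_x(v)` and the canonical ranking (largest `R` first, ties by index)
  set R : Fin n → ℝ := fun x => ∑ j ∈ Finset.range (A.card + 1), v ^ j * μ.real {ω : BondConfig (Fin n) |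
      (A.filter fun z => ω ∈ openConn x z).card = j} with hR
  set rk : Fin n → ℕ := fun x => (A.filter fun z => R x < R z ∨ (R z = R x ∧ z < x)).card with hrk
  have hinj : Set.InjOn rk ↑A := rank_injOn A R
  have hanti : ∀ x ∈ A, ∀ y ∈ A, rk x < rk y → R y ≤ R x :=
    fun x hx y hy h => rank_antitone A R hx hy h
  obtain ⟨a, ha, hmax⟩ := Finset.exists_max_image A R hA
  refine ⟨a, ha, ?_⟩
  -- the top events and their moment sums `T_x(v)`
  set W : Fin n → ℕ → Set (BondConfig (Fin n)) := fun x j =>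
    ({ω : BondConfig (Fin n) | (A.filter fun z => ω ∈ openConn o z).card = j} ∩
      {ω | ω ∈ openConn o x} ∩ {ω | ∀ y ∈ A, rk y < rk x → ω ∉ openConn o y}) with hW
  set T : Fin n → ℝ := fun x => ∑ j ∈ Finset.Icc 1 A.card, v ^ j * μ.real (W x j) with hT
  have hpack : ∑ x ∈ A, T x / R x ≤ C := hGTP n w A o v rk hv0 hv1 ho hinj hanti
  have hv0' : 0 ≤ v := hv0.le
  -- (1) `L(v) = Σ_x T_x(v)`
  have hL : ∑ j ∈ Finset.Icc 1 A.card, v ^ j * μ.real {ω : BondConfig (Fin n) |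
        (A.filter fun z => ω ∈ openConn o z).card = j} = ∑ x ∈ A, T x := by
    have hlev : ∀ j ∈ Finset.Icc 1 A.card, v ^ j * μ.real {ω : BondConfig (Fin n) |
        (A.filter fun z => ω ∈ openConn o z).card = j} = ∑ x ∈ A, v ^ j * μ.real (W x j) := by
      intro j hj
      rw [real_level_eq_sum w A o (Finset.mem_Icc.1 hj).1 rk hinj, Finset.mul_sum]
    rw [Finset.sum_congr rfl hlev, Finset.sum_comm]
  -- (2) `T_x ≤ R_x`
  have hTR : ∀ x ∈ A, T x ≤ R x := by
    intro x _
    calc T x = ∑ j ∈ Finset.Icc 1 A.card, v ^ j * μ.real (W x j) := rfl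
      _ ≤ ∑ j ∈ Finset.Icc 1 A.card, v ^ j * μ.real {ω : BondConfig (Fin n) |
            (A.filter fun z => ω ∈ openConn x z).card = j} :=
          Finset.sum_le_sum fun j _ => mul_le_mul_of_nonneg_left
            (measureReal_mono (level_top_subset A o x j rk) (measure_ne_top _ _)) (pow_nonneg hv0' j)
      _ ≤ R x := by
          refine Finset.sum_le_sum_of_subset_of_nonneg (fun j hj => ?_)
            fun j _ _ => mul_nonneg (pow_nonneg hv0' j) measureReal_nonneg
          rw [Finset.mem_range]; exact Nat.lt_succ_of_le (Finset.mem_Icc.1 hj).2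
  have hR0 : ∀ x, 0 ≤ R x := fun x =>
    Finset.sum_nonneg fun j _ => mul_nonneg (pow_nonneg hv0' j) measureReal_nonneg
  have hT0 : ∀ x, 0 ≤ T x := fun x =>
    Finset.sum_nonneg fun j _ => mul_nonneg (pow_nonneg hv0' j) measureReal_nonneg
  -- (3) `T_x ≤ R_a · (T_x / R_x)`
  have hterm : ∀ x ∈ A, T x ≤ R a * (T x / R x) := by
    intro x hx
    rcases eq_or_lt_of_le (hR0 x) with h0 | hpos
    · have hT0' : T x = 0 := le_antisymm (h0 ▸ hTR x hx) (hT0 x)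
      rw [hT0']; simp
    · calc T x = R x * (T x / R x) := by field_simp
        _ ≤ R a * (T x / R x) :=
          mul_le_mul_of_nonneg_right (hmax x hx) (div_nonneg (hT0 x) (hR0 x))
  calc ∑ j ∈ Finset.Icc 1 A.card, v ^ j * μ.real {ω : BondConfig (Fin n) |
          (A.filter fun z => ω ∈ openConn o z).card = j}
      = ∑ x ∈ A, T x := hL
    _ ≤ ∑ x ∈ A, R a * (T x / R x) := Finset.sum_le_sum hterm
    _ = R a * ∑ x ∈ A, T x / R x := by rw [Finset.mul_sum]
    _ ≤ R a * C := mul_le_mul_of_nonneg_left hpack (hR0 a)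
    _ = C * R a := mul_comm _ _

end Summit.CriticalPhenomena.PercolationContinuityZ3.Theorems

end
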